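import Literature.MathematicalPhysics.QuantumFieldTheory.Balaban1983to89.B9Cor36SiteSandwichTransfer

/-!
# `Balaban1983to89.B9Cor36GpCubeEntriesAtV` — [Balaban1985BackgroundPropagators] COROLLARY 3.6 p. 408 AT ONE COVER CUBE □: THE FOUR (3.42) ENTRIES OF
# THE CUBE LETTER `G′_□(Ṽ_□)` WITH THE DERIVATIVES AT `Ṽ_□` — `|G′_□λ|, |∇_{Ṽ}G′_□λ|, |G′_□∇*_{Ṽ}λ|, |Δ_{Ṽ}G′_□λ| ≦ B[(Lⁿη)², Lⁿη, Lⁿη, 1]e^{−δd}|λ|` —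
# as conj-`b` block majorants over the CUBE SEQUENCE's blocks, from FILE 7b-A's package by the `(Ṽ_□ − 1)`-shift corrections of the derivative
# letters and the equation `Δ_{Ṽ}G′_□ = 1 − (averaging)·G′_□` — sub-row G-B9-LETTERS, module M5.1b-G′ (site sector), FILE 7b-C of seat p33's plan

statement-level skeleton of published theorems with citation tags; proofs where landed; nothing here is a claim about the Yang–Mills mass gap

CITATION HEADER (lean-in-tree rule).  B9 = T. Bałaban, *Propagators for lattice gauge theories in a background field*, Commun. Math. Phys. **99** (1985)
389–434 [Balaban1985BackgroundPropagators] (held `paper:balaban1985-cmp99-background-propagators`; journal page = PDF page + 388): Cor. 3.6 p. 408 l. 1–10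
(«U′ = U^u = e^{iηA} … satisfies (3.37) for the sequence {Ω′_j} with U = 1 … the operators G_□(U), G′_□(U) … satisfy (3.42)–(3.47)»); Thm 3.1 (3.42) p. 397
(«|(G′(U)λ)(x)|, |(∇_U G′(U)λ)(x)|, |(G′(U)∇*_U λ)(x)|, |(Δ_U G′(U)λ)(x)| ≦ B₀[(Lʲη)², Lʲη, Lʲη, 1]e^{−δ₀d(y,y′)}|λ|»); Thm 3.4 p. 400 («The extended operators
satisfy all the inequalities of Theorems 3.1–3.3 correspondingly»); p. 403 l. 1–9 and (3.70) p. 404 (`∇_{U′U} = ∇_U + (U′ − 1)`-terms); (3.37) p. 396; (3.24)–(3.25)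
p. 394 (`Δ′_a = Δ_U + Σ a_j(Lʲη)⁻²Q′_j*Q′_j`, `G′ = (Δ′_a)⁻¹`); (3.19) p. 393; p. 398 (remark after (3.47): scale transfer).  [4] = [Balaban1984PropagatorsII] (2.51)–(2.55)
p. 232, (2.60)–(2.63) p. 234, (2.14) p. 225.  Rows B9.Cor3.6 × B9.Thm3.4 × B9.Eq3.42 (cells only; no row head changes).

WHY THIS FILE (cell lit-balaban, sub-row G-B9-LETTERS, module M5.1b-G′ booked to seat p33; FILE 7b «hE», step (ii) of `lit-balaban-p33/RECORD-M51bGp-g96.md`).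
FILE 7b-A (`B9Cor36GpCubeExtAtV.gp_cube_at_locCfg`) delivers, for `conj b(η²G′_□(Ṽ_□))`, the base entries AT `U = 1` and Sect. B's two transfer clauses.  The
member-side (3.42) block of p21's M5.5 FILE 6 (`hE`, FILE 7b-D) reads the derivatives AT THE CONFIGURATION, i.e. `∇_{Ṽ_□}`, `∇*_{Ṽ_□}`, `Δ_{Ṽ_□}` after the
plateau identities.  THIS FILE closes the gap on the cube side: (a) `∇_{Ṽ,k} − ∇_{1,k} = (R(Ṽ) − 1)∘σ_{±e_μ}` is a SITE-LOCAL multiplier of size `5α₁(Lⁿη)⁻¹`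
((3.37): `η|Ã| ≤ ηα₁(Lⁿη)⁻¹ ≤ 1/4`) after a one-step translation (§§1–2), so `∇_{Ṽ,k}·G′_□(Ṽ_□)` and `G′_□(Ṽ_□)·∇*_{Ṽ,μ}` inherit the (3.42)₂,₃ shape from
the transferred base entries by [4]'s shift calculus (FILE 5b's `hasMajorant_shift_mul_weighted` and its right twin here, §3); (b) `η⁻²Δ_{Ṽ}·η²G′_□(Ṽ_□) =
1 − η⁻²(Q′*aQ′)_□(Ṽ_□)·η²G′_□(Ṽ_□)` (the equation, `Δ′_{a,□}(Ṽ_□)G′_□(Ṽ_□) = 1`), the averaging term being a BLOCK-LOCAL letter of size `(1 + C_qα₁)²(Lⁿη)⁻²`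
((3.19)/(3.59), FILE 1's word form), gives (3.42)₄ with NO derivative (§4); (c) ★★★ `gp_cube_entries_at_locCfg` (§5): the four entries at one constant and
one rate `(4/5)δ₀`, uniformly in the member and the cube, under FILE 7a's (3.35) cube datum and smallness.

WHAT IS PROVED (4 `def`s with bodies — `shiftOpY`, `shiftOpY'` (the one-step translations of `𝔸`-valued site functions), `mulDefF`, `mulDefB` (the
`(Ṽ − 1)`-defect multipliers) —; theorems; 0 sorry; 0 new named facts; standard axioms): §1 `shiftOpY_liftY`, `shiftOpY'_liftY`, ★`hasMajorant_conj_shiftOpY`,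
★`hasMajorant_conj_shiftOpY'`; §2 ★`diffLetter_inl_eq_add`, ★`diffLetter_inr_eq_sub` (the defect identities), `norm_R_sub_self_le_of_small`,
★`norm_mulDefF_apply_le`, ★`norm_mulDefB_apply_le` (site-local, `5α₁(Lⁿη)⁻¹`); §3 ★`hasMajorant_weighted_mul_shift` (right twin of FILE 5b's shift rule),
`hasMajorant_one_decay`; §4 ★`norm_avgCube_apply_le` (the averaging term of `Δ′_{a,□}(Ṽ_□)` is block-local of size `(1 + C_qα₁)²(Lⁿη)⁻²`), `conj_lapSL_eq`;
§5 ★★★`gp_cube_entries_at_locCfg`.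

PROOF.  Ours, following p. 403's treatment of `∇_{U′U} − ∇_U` and (3.24)–(3.25); [4]'s majorant calculus (FILE 5b, `B6RandomWalk`) by name.

HONEST SCOPE / NOT CLAIMED.  `[NormOneClass 𝔸]`; the (3.35) cube datum, `α₁ := max C (C(1+D₁θ))·Λ² ≤ min(a₁, 1/4)` and the member thresholds are displayed
hypotheses (as FILES 7a/7b-A); the right entry is proved for the backward letter `∇*_μ` only (the one (3.42)₃ names; p. 398's «conventional» remark covers
the other); the member-side block `hE` is FILE 7b-D; nothing on `d = 4`, the continuum, reflection positivity or the mass gap; NOT a node discharge; no row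
head changes.

RELATED IN THE TREE, NOT DUPLICATED: FILE 5b `B9Cor35GpCubeInputsAtOne` (shift calculus at `U = 1`, scalar matrices), n06-c `B9SectBGpTransferOutY.norm_R_sub_self_le`
/ `cdS_mulY_apply` (the member's `∇_{U′U}` split — same mechanism, other carrier; not imported), r06 `B9Eq360VprimeLetters.norm_avgOp_le` (the three
(3.60) words; here the single (3.24) word at `Ṽ_□`).
-/

noncomputable section

namespace Literature.MathematicalPhysics.QuantumFieldTheory.Balaban1983to89.B9Cor36GpCubeEntriesAtV

open Literature.MathematicalPhysics.QuantumFieldTheory.Balaban1983to89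
open Literature.MathematicalPhysics.QuantumFieldTheory.Balaban1983to89.B4PartitionUnity22 (thetaProf D1)
open Literature.MathematicalPhysics.QuantumFieldTheory.Balaban1983to89.B6RandomWalk (HasMajorant BlockSupp hasMajorant_mono Triangle254 Ineq261 c1_nonneg
  hasMajorant_add)
open Literature.MathematicalPhysics.QuantumFieldTheory.Balaban1983to89.B9Thm34Ext (toB6)
open Literature.MathematicalPhysics.QuantumFieldTheory.Balaban1983to89.B9Ineq347 (ScaleTransfer)
open Literature.MathematicalPhysics.QuantumFieldTheory.Balaban1983to89.B9Eq39Adjoint (R R_zero R_smul R_add R_sub R_one fluct covD covDstar)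
open Literature.MathematicalPhysics.QuantumFieldTheory.Balaban1983to89.B9Eq352DivForm (tauB)
open Literature.MathematicalPhysics.QuantumFieldTheory.Balaban1983to89.B9Eq352DivFormLetters (conj conj_apply conj_sub conj_neg coordEquiv gradLetterF gradLetterB)
open Literature.MathematicalPhysics.QuantumFieldTheory.Balaban1983to89.B9Eq352GradLetters (diffLetter diffLetter_inl diffLetter_inr)
open Literature.MathematicalPhysics.QuantumFieldTheory.Balaban1983to89.B9Eq360Vprime (liftOp diagOp kerOp liftOp_apply diagOp_apply norm_starTerm_le)
open Literature.MathematicalPhysics.QuantumFieldTheory.Balaban1983to89.B6KLevelCensusIndexV1 (KIdx kGeo)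
open Literature.MathematicalPhysics.QuantumFieldTheory.Balaban1983to89.B6Cover236MultiLevelBlocks (cubes)
open Literature.MathematicalPhysics.QuantumFieldTheory.Balaban1983to89.B6GlobalChartV1 (PV boxEquiv)
open Literature.MathematicalPhysics.QuantumFieldTheory.Balaban1983to89.B6MultiLevelTorusOperator (tshift tshift_symm_apply unitVec shiftMat shiftMat_mulVec)
open Literature.MathematicalPhysics.QuantumFieldTheory.Balaban1983to89.B9BackgroundsKLevelV1 (shiftsV1)
open Literature.MathematicalPhysics.QuantumFieldTheory.Balaban1983to89.B9Eq360DeltaPrimeAY (Rclm AfldY chartA chartA_apply)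
open Literature.MathematicalPhysics.QuantumFieldTheory.Balaban1983to89.B9Eq360DeltaPrimeACubeY (blkCubeY blkCubeY_apply kQCubeY sQCubeY cCubeY kFCubeY sFCubeY
  levCubeY_eq avgTermCube_eq_word)
open Literature.MathematicalPhysics.QuantumFieldTheory.Balaban1983to89.B9CubeLettersOpsL0 (cubeFamY levCubeY deltaPrimeACubeY avgCoeffCubeY avgTrCubeY)
open Literature.MathematicalPhysics.QuantumFieldTheory.Balaban1983to89.B9CubeLettersBondOpsL0 (BlkCubeY)
open Literature.MathematicalPhysics.QuantumFieldTheory.Balaban1983to89.B9CubeGeometryInputs (geoCK geoCK_len geoCK_eta geoCK_eta_pos geoCK_dist geoCK_dist_axioms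
  geoCK_len_pos geoCK_eta_le_len geoCK_len_blkCubeY RM1 N1 exists_h261_geoCK hST_geoCK stencil_geoCK geoCK_site_nonempty)
open Literature.MathematicalPhysics.QuantumFieldTheory.Balaban1983to89.B9Cor35GpCubeInputsAtOne (GpK wK cfunK eta_ne_zero wK_nonneg card_block_mul_wK_le
  norm_kQCubeY_one_le norm_sQCubeY_one_le abs_cfunK_le hasMajorant_conj_of_liftY hasMajorant_shiftMat hasMajorant_shift_mul_weighted liftY_smul)
open Literature.MathematicalPhysics.QuantumFieldTheory.Balaban1983to89.B9Cor35GpAtCubeLetters (hasMajorant_weaken)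
open Literature.MathematicalPhysics.QuantumFieldTheory.Balaban1983to89.B9Cor36CutoffField337 (cutFldY)
open Literature.MathematicalPhysics.QuantumFieldTheory.Balaban1983to89.B9Cor36CubeCutoffs (SC NearC chiTY locCfgY locCfgY_apply)
open Literature.MathematicalPhysics.QuantumFieldTheory.Balaban1983to89.B9Eq359CubeKernelsAtOne (Cq Cq_nonneg)
open Literature.MathematicalPhysics.QuantumFieldTheory.Balaban1983to89.B9Cor36GpCubeExtAtV (VpK GpVK DpK_sub_VpK DpK_sub_VpK_mul_GpVK gp_cube_at_locCfg)
open Literature.MathematicalPhysics.QuantumFieldTheory.Balaban1983to89.B9Cor36SiteSandwichTransfer (hasMajorant_mul_of_rowLocal hasMajorant_mul_of_rowLocal_right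
  rowLocal_conj_of_local)
open Literature.MathematicalPhysics.QuantumFieldTheory.Balaban1983to89.Node00 (SiteY CfgY GaugeY SiteParY toKT shiftY gaugeY parSymY parSymY_one UboxY liftY liftY_apply
  lapSL kernelTrOpY)

variable {d ℓ : ℕ} {hd : 1 ≤ d + 1} {hL : Odd (ℓ + 1) ∧ 1 < ℓ + 1} {b₀ b₁ : ℝ}
variable {𝔸 : Type} [NormedRing 𝔸] [NormedAlgebra ℂ 𝔸] [CompleteSpace 𝔸]
variable {ι : Type} [Fintype ι]

/-! ## §1  The one-step translations of `𝔸`-valued site functions and their block majorants -/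

section Shift

variable (i : KIdx d ℓ hd hL b₀ b₁) (c : ↥(cubes (toKT i).D.toDomains)) (b : Module.Basis ι ℝ 𝔸)

/-- **the forward translation `(σ_μ f)(z) = f(z + e_μ)`** of `𝔸`-valued site functions (the shift inside `∇_μ`, (3.3)). [cite: Balaban1985BackgroundPropagators, (3.3) p.390, dictionary] -/
def shiftOpY (μ : Fin (d + 1)) : (SiteY i → 𝔸) →ₗ[ℂ] (SiteY i → 𝔸) where
  toFun f := fun z => f (shiftY i μ z)
  map_add' _ _ := rfl
  map_smul' _ _ := rfl

/-- **the backward translation `(σ_{−μ} f)(z) = f(z − e_μ)`** (the shift inside `∇*_μ`, (3.8)). [cite: Balaban1985BackgroundPropagators, (3.8) p.392, dictionary] -/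
def shiftOpY' (μ : Fin (d + 1)) : (SiteY i → 𝔸) →ₗ[ℂ] (SiteY i → 𝔸) where
  toFun f := fun z => f ((shiftY i μ).symm z)
  map_add' _ _ := rfl
  map_smul' _ _ := rfl

omit [CompleteSpace 𝔸] in
/-- `σ_μ(f ⊗ E) = (σ_μ f) ⊗ E` with N03's translation matrix. [cite: Balaban1985BackgroundPropagators, (3.3) p.390, bookkeeping] -/
theorem shiftOpY_liftY (μ : Fin (d + 1)) (f : SiteY i → ℝ) (E : 𝔸) :
    (shiftOpY i μ).restrictScalars ℝ (liftY f E) = liftY (Matrix.toLin' (shiftMat (toKT i).NB ((1 : ℤ) • unitVec μ)) f) E := by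
  funext z
  have e : shiftY i μ z = tshift (toKT i).NB ((1 : ℤ) • unitVec μ) z := by rw [one_smul]; rfl
  show liftY f E (shiftY i μ z) = _
  rw [liftY_apply, liftY_apply, Matrix.toLin'_apply, shiftMat_mulVec, e]

omit [CompleteSpace 𝔸] in
/-- `σ_{−μ}(f ⊗ E) = (σ_{−μ} f) ⊗ E`. [cite: Balaban1985BackgroundPropagators, (3.8) p.392, bookkeeping] -/
theorem shiftOpY'_liftY (μ : Fin (d + 1)) (f : SiteY i → ℝ) (E : 𝔸) :
    (shiftOpY' i μ).restrictScalars ℝ (liftY f E) = liftY (Matrix.toLin' (shiftMat (toKT i).NB ((-1 : ℤ) • unitVec μ)) f) E := by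
  funext z
  have e : (shiftY i μ).symm z = tshift (toKT i).NB ((-1 : ℤ) • unitVec μ) z := by rw [neg_one_smul]; exact tshift_symm_apply _ _ _
  show liftY f E ((shiftY i μ).symm z) = _
  rw [liftY_apply, liftY_apply, Matrix.toLin'_apply, shiftMat_mulVec, e]

omit [CompleteSpace 𝔸] in
/-- ★ `conj b(σ_μ) ≺ e^{θ}·e^{−θd}` over the cube sequence's blocks (`θ ≥ 0`; FILE 5b's `hasMajorant_shiftMat` through the coordinates).
[cite: Balaban1984PropagatorsII, (2.51) p.232, (2.46) p.231; Balaban1985BackgroundPropagators, (3.60) p.402 (stencil)] -/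
theorem hasMajorant_conj_shiftOpY (Rr : ℝ) (H : Prop) {θ : ℝ} (hθ : 0 ≤ θ) (μ : Fin (d + 1)) :
    HasMajorant (g := toB6 (geoCK i c) Rr H) (fun p : SiteY i × ι => blkCubeY i c p.1) (conj b ((shiftOpY (𝔸 := 𝔸) i μ).restrictScalars ℝ))
      (fun a a' => Real.exp θ * Real.exp (-(θ * (geoCK i c).dist a a'))) :=
  hasMajorant_conj_of_liftY b (g := toB6 (geoCK i c) Rr H) (blkCubeY i c) _ _ (shiftOpY_liftY i μ) (hasMajorant_shiftMat i c Rr H hθ μ 1 (Or.inl rfl))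

omit [CompleteSpace 𝔸] in
/-- ★ `conj b(σ_{−μ}) ≺ e^{θ}·e^{−θd}` over the cube sequence's blocks. [cite: Balaban1984PropagatorsII, (2.51) p.232, (2.46) p.231] -/
theorem hasMajorant_conj_shiftOpY' (Rr : ℝ) (H : Prop) {θ : ℝ} (hθ : 0 ≤ θ) (μ : Fin (d + 1)) :
    HasMajorant (g := toB6 (geoCK i c) Rr H) (fun p : SiteY i × ι => blkCubeY i c p.1) (conj b ((shiftOpY' (𝔸 := 𝔸) i μ).restrictScalars ℝ))
      (fun a a' => Real.exp θ * Real.exp (-(θ * (geoCK i c).dist a a'))) :=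
  hasMajorant_conj_of_liftY b (g := toB6 (geoCK i c) Rr H) (blkCubeY i c) _ _ (shiftOpY'_liftY i μ) (hasMajorant_shiftMat i c Rr H hθ μ (-1) (Or.inr rfl))

end Shift

/-! ## §2  The `(Ṽ − 1)`-defect multipliers: `∇_{V,μ} = ∇_{1,μ} + (R(V_μ) − 1)σ_μ`, `−∇*_{V,μ} = −∇*_{1,μ} − (R(V_μ(· − e_μ))⁻¹ − 1)σ_{−μ}` -/

section Defect

variable (i : KIdx d ℓ hd hL b₀ b₁) (c : ↥(cubes (toKT i).D.toDomains))

/-- **the forward defect multiplier** `f ↦ (z ↦ c·(R(V_μ(z))f(z) − f(z)))` (site-local). [cite: Balaban1985BackgroundPropagators, p.403 l.1–9, (3.70) p.404 («∇_{U′U} − ∇_U»)] -/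
def mulDefF (V : CfgY 𝔸 i) (cc : ℂ) (μ : Fin (d + 1)) : Module.End ℝ (SiteY i → 𝔸) where
  toFun f := fun z => cc • (R (UboxY i V μ z) (f z) - f z)
  map_add' f g := by
    funext z
    simp only [Pi.add_apply, R_add, add_sub_add_comm, ← smul_add]
  map_smul' r f := by
    funext z
    simp only [Pi.smul_apply, RingHom.id_apply]
    rw [← Complex.coe_smul, ← Complex.coe_smul, R_smul, ← smul_sub, smul_comm]

/-- **the backward defect multiplier** `f ↦ (z ↦ c·(R(V_μ(z − e_μ))⁻¹f(z) − f(z)))` (site-local). [cite: Balaban1985BackgroundPropagators, p.403 l.1–9, (3.8) p.392] -/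
def mulDefB (V : CfgY 𝔸 i) (cc : ℂ) (μ : Fin (d + 1)) : Module.End ℝ (SiteY i → 𝔸) where
  toFun f := fun z => cc • (R (UboxY i V μ ((shiftY i μ).symm z))⁻¹ (f z) - f z)
  map_add' f g := by
    funext z
    simp only [Pi.add_apply, R_add, add_sub_add_comm, ← smul_add]
  map_smul' r f := by
    funext z
    simp only [Pi.smul_apply, RingHom.id_apply]
    rw [← Complex.coe_smul, ← Complex.coe_smul, R_smul, ← smul_sub, smul_comm]

/-- `mulDefF` applied. [cite: Balaban1985BackgroundPropagators, p.403, bookkeeping] -/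
@[simp] theorem mulDefF_apply (V : CfgY 𝔸 i) (cc : ℂ) (μ : Fin (d + 1)) (f : SiteY i → 𝔸) (z : SiteY i) :
    mulDefF i V cc μ f z = cc • (R (UboxY i V μ z) (f z) - f z) := rfl

/-- `mulDefB` applied. [cite: Balaban1985BackgroundPropagators, p.403, bookkeeping] -/
@[simp] theorem mulDefB_apply (V : CfgY 𝔸 i) (cc : ℂ) (μ : Fin (d + 1)) (f : SiteY i → 𝔸) (z : SiteY i) :
    mulDefB i V cc μ f z = cc • (R (UboxY i V μ ((shiftY i μ).symm z))⁻¹ (f z) - f z) := rfl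

/-- ★ **`∇_{V,μ} = ∇_{1,μ} + (R(V_μ) − 1)σ_μ`** for the directional letters (`c·D_{V,μ}f(z) = c(R(V_μ z)f(z+e_μ) − f z)`).
[cite: Balaban1985BackgroundPropagators, p.403 l.1–9, (3.70) p.404, (3.3) p.390] -/
theorem diffLetter_inl_eq_add (V : CfgY 𝔸 i) (cc : ℂ) (μ : Fin (d + 1)) :
    diffLetter (shiftY i) (UboxY i V) cc (Sum.inl μ) =
      diffLetter (shiftY i) (fun _ _ => (1 : 𝔸ˣ)) cc (Sum.inl μ) + mulDefF i V cc μ * (shiftOpY i μ).restrictScalars ℝ := by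
  refine LinearMap.ext fun f => funext fun z => ?_
  rw [diffLetter_inl, diffLetter_inl, LinearMap.add_apply, Module.End.mul_apply, Pi.add_apply, mulDefF_apply]
  show cc • covD (shiftY i) (UboxY i V) μ f z = cc • covD (shiftY i) (fun _ _ => (1 : 𝔸ˣ)) μ f z + cc • (R (UboxY i V μ z) (f (shiftY i μ z)) - f (shiftY i μ z))
  rw [covD, covD, R_one, ← smul_add]
  congr 1
  abel

/-- ★ **`−∇*_{V,μ} = −∇*_{1,μ} − (R(V_μ(· − e_μ))⁻¹ − 1)σ_{−μ}`** for the directional letters (`diffLetter (inr μ) = −c·D*_{V,μ}`).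
[cite: Balaban1985BackgroundPropagators, p.403 l.1–9, (3.8) p.392] -/
theorem diffLetter_inr_eq_sub (V : CfgY 𝔸 i) (cc : ℂ) (μ : Fin (d + 1)) :
    diffLetter (shiftY i) (UboxY i V) cc (Sum.inr μ) =
      diffLetter (shiftY i) (fun _ _ => (1 : 𝔸ˣ)) cc (Sum.inr μ) - mulDefB i V cc μ * (shiftOpY' i μ).restrictScalars ℝ := by
  refine LinearMap.ext fun f => funext fun z => ?_
  rw [diffLetter_inr, diffLetter_inr, LinearMap.sub_apply, Module.End.mul_apply, Pi.sub_apply, LinearMap.neg_apply, LinearMap.neg_apply, Pi.neg_apply,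
    Pi.neg_apply, mulDefB_apply]
  show -(cc • covDstar (shiftY i) (UboxY i V) μ f z) =
    -(cc • covDstar (shiftY i) (fun _ _ => (1 : 𝔸ˣ)) μ f z) - cc • (R (UboxY i V μ ((shiftY i μ).symm z))⁻¹ (f ((shiftY i μ).symm z)) - f ((shiftY i μ).symm z))
  rw [covDstar, covDstar, inv_one, R_one, ← smul_neg, ← smul_neg, ← smul_sub]
  congr 1
  abel

omit [NormedAlgebra ℂ 𝔸] [CompleteSpace 𝔸] in
/-- `‖R(W)a − a‖ ≤ 5x‖a‖` when `‖W − 1‖, ‖W⁻¹ − 1‖ ≤ 2x`, `0 ≤ x ≤ 1/4`, `‖1‖ ≤ 1` (`R(W)a − a = (W − 1)aW⁻¹ + a(W⁻¹ − 1)`).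
[cite: Balaban1985BackgroundPropagators, (3.70) p.404, (3.37) p.396, bookkeeping] -/
theorem norm_R_sub_self_le_of_small [NormOneClass 𝔸] (W : 𝔸ˣ) {x : ℝ} (hx : 0 ≤ x) (hx4 : x ≤ 1 / 4) (h1 : ‖(W : 𝔸) - 1‖ ≤ 2 * x)
    (h2 : ‖((W⁻¹ : 𝔸ˣ) : 𝔸) - 1‖ ≤ 2 * x) (a : 𝔸) : ‖R W a - a‖ ≤ 5 * x * ‖a‖ := by
  have h : R W a - a = ((W : 𝔸) - 1) * a * ((W⁻¹ : 𝔸ˣ) : 𝔸) + a * (((W⁻¹ : 𝔸ˣ) : 𝔸) - 1) := by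
    simp only [R, sub_mul, mul_sub, one_mul, mul_one]; abel
  have hinv : ‖((W⁻¹ : 𝔸ˣ) : 𝔸)‖ ≤ 1 + 2 * x := by
    calc ‖((W⁻¹ : 𝔸ˣ) : 𝔸)‖ = ‖(((W⁻¹ : 𝔸ˣ) : 𝔸) - 1) + 1‖ := by rw [sub_add_cancel]
      _ ≤ ‖((W⁻¹ : 𝔸ˣ) : 𝔸) - 1‖ + ‖(1 : 𝔸)‖ := norm_add_le _ _
      _ ≤ 2 * x + 1 := add_le_add h2 norm_one.le
      _ = 1 + 2 * x := by ring
  rw [h]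
  calc ‖((W : 𝔸) - 1) * a * ((W⁻¹ : 𝔸ˣ) : 𝔸) + a * (((W⁻¹ : 𝔸ˣ) : 𝔸) - 1)‖
      ≤ ‖(W : 𝔸) - 1‖ * ‖a‖ * ‖((W⁻¹ : 𝔸ˣ) : 𝔸)‖ + ‖a‖ * ‖((W⁻¹ : 𝔸ˣ) : 𝔸) - 1‖ :=
        (norm_add_le _ _).trans (add_le_add ((norm_mul_le _ _).trans (mul_le_mul_of_nonneg_right (norm_mul_le _ _) (norm_nonneg _))) (norm_mul_le _ _))
    _ ≤ (2 * x) * ‖a‖ * (1 + 2 * x) + ‖a‖ * (2 * x) := by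
        have ha := norm_nonneg a
        refine add_le_add (mul_le_mul (mul_le_mul_of_nonneg_right h1 ha) hinv (norm_nonneg _) (by positivity)) (mul_le_mul_of_nonneg_left h2 ha)
    _ = (4 * x + 4 * x * x) * ‖a‖ := by ring
    _ ≤ 5 * x * ‖a‖ := by
        have hxx : 4 * x * x ≤ x := by nlinarith
        exact mul_le_mul_of_nonneg_right (by linarith) (norm_nonneg a)

variable [NormOneClass 𝔸]

/-- ★ **THE FORWARD DEFECT IS SITE-LOCAL OF SIZE `5α₁(Lⁿη)⁻¹`** at the localised field `Ṽ_□ = e^{iηÃ}·1` under the (3.37) reading `‖Ã_μ(z)‖ ≤ α₁(L^{n(z)}η)⁻¹`,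
`α₁ ≤ 1/4` (so `η‖Ã‖ ≤ ηα₁(Lⁿη)⁻¹ ≤ α₁`): `‖(mulDefF Ṽ η⁻¹ μ f)(z)‖ ≤ 5α₁(L^{n(z)}η)⁻¹‖f(z)‖`.
[cite: Balaban1985BackgroundPropagators, (3.37) p.396, p.403 l.1–9, p.401 («|Q_l(U, ξA′)| < 2α₁L^lξ»)] -/
theorem norm_mulDefF_apply_le (A : AfldY 𝔸 i) {α₁ : ℝ} (hα₁0 : 0 ≤ α₁) (hα4 : α₁ ≤ 1 / 4)
    (hA : ∀ k x, ‖chartA i (cutFldY i (chiTY i c) A) k x‖ ≤ α₁ * ((geoCK i c).len (blkCubeY i c x))⁻¹) (μ : Fin (d + 1))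
    (f : SiteY i → 𝔸) (z : SiteY i) :
    ‖mulDefF i (locCfgY i c (kGeo i).eta A) ((((kGeo i).eta : ℂ))⁻¹) μ f z‖ ≤ 5 * α₁ * ((geoCK i c).len (blkCubeY i c z))⁻¹ * ‖f z‖ := by
  have hη : 0 < (kGeo i).eta := by rw [← geoCK_eta i c]; exact geoCK_eta_pos i c
  have hlen := geoCK_len_pos i c (blkCubeY i c z)
  have hηlen : (kGeo i).eta ≤ (geoCK i c).len (blkCubeY i c z) := by rw [← geoCK_eta i c]; exact geoCK_eta_le_len i c _
  set x : ℝ := (kGeo i).eta * (α₁ * ((geoCK i c).len (blkCubeY i c z))⁻¹) with hxdef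
  have hx0 : 0 ≤ x := mul_nonneg hη.le (mul_nonneg hα₁0 (inv_nonneg.2 hlen.le))
  have hx4 : x ≤ 1 / 4 := by
    have h1 : (kGeo i).eta * ((geoCK i c).len (blkCubeY i c z))⁻¹ ≤ 1 := by
      rw [← div_eq_mul_inv, div_le_one hlen]; exact hηlen
    calc x = α₁ * ((kGeo i).eta * ((geoCK i c).len (blkCubeY i c z))⁻¹) := by rw [hxdef]; ring
      _ ≤ α₁ * 1 := mul_le_mul_of_nonneg_left h1 hα₁0
      _ ≤ 1 / 4 := by linarith
  have hW : UboxY i (locCfgY i c (kGeo i).eta A) μ z = fluct (kGeo i).eta (cutFldY i (chiTY i c) A) μ ((boxEquiv i.hN).symm z) := by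
    show locCfgY i c (kGeo i).eta A μ ((boxEquiv i.hN).symm z) = _
    rw [locCfgY_apply]
  have hxA : (kGeo i).eta * ‖cutFldY i (chiTY i c) A μ ((boxEquiv i.hN).symm z)‖ ≤ x := by
    rw [hxdef]; exact mul_le_mul_of_nonneg_left (by simpa only [chartA_apply] using hA μ z) hη.le
  obtain ⟨h1, h2⟩ := B9Eq358TaxiLettersY.norm_fluct_sub_one_le i hη.le (cutFldY i (chiTY i c) A) μ ((boxEquiv i.hN).symm z) hxA hx4
  rw [mulDefF_apply, norm_smul, norm_inv, Complex.norm_real, Real.norm_eq_abs, abs_of_pos hη, hW]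
  calc (kGeo i).eta⁻¹ * ‖R (fluct (kGeo i).eta (cutFldY i (chiTY i c) A) μ ((boxEquiv i.hN).symm z)) (f z) - f z‖
      ≤ (kGeo i).eta⁻¹ * (5 * x * ‖f z‖) := mul_le_mul_of_nonneg_left (norm_R_sub_self_le_of_small _ hx0 hx4 h1 h2 (f z)) (inv_nonneg.2 hη.le)
    _ = ((kGeo i).eta⁻¹ * (kGeo i).eta) * (5 * α₁ * ((geoCK i c).len (blkCubeY i c z))⁻¹ * ‖f z‖) := by rw [hxdef]; ring
    _ = 5 * α₁ * ((geoCK i c).len (blkCubeY i c z))⁻¹ * ‖f z‖ := by rw [inv_mul_cancel₀ hη.ne', one_mul]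

/-- ★ **THE BACKWARD DEFECT IS SITE-LOCAL OF SIZE `5α₁(Lⁿη)⁻¹`** at `Ṽ_□`, under the shifted (3.37) reading `‖Ã_μ(z − e_μ)‖ ≤ α₁(L^{n(z)}η)⁻¹` (FILE 4's `hAτB`).
[cite: Balaban1985BackgroundPropagators, (3.37) p.396, p.403 l.1–9, (3.8) p.392] -/
theorem norm_mulDefB_apply_le (A : AfldY 𝔸 i) {α₁ : ℝ} (hα₁0 : 0 ≤ α₁) (hα4 : α₁ ≤ 1 / 4)
    (hAτ : ∀ ν k x, ‖tauB (shiftY i) (fun _ _ => (1 : 𝔸ˣ)) ν (chartA i (cutFldY i (chiTY i c) A) k) x‖ ≤ α₁ * ((geoCK i c).len (blkCubeY i c x))⁻¹)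
    (μ : Fin (d + 1)) (f : SiteY i → 𝔸) (z : SiteY i) :
    ‖mulDefB i (locCfgY i c (kGeo i).eta A) ((((kGeo i).eta : ℂ))⁻¹) μ f z‖ ≤ 5 * α₁ * ((geoCK i c).len (blkCubeY i c z))⁻¹ * ‖f z‖ := by
  have hη : 0 < (kGeo i).eta := by rw [← geoCK_eta i c]; exact geoCK_eta_pos i c
  have hlen := geoCK_len_pos i c (blkCubeY i c z)
  have hηlen : (kGeo i).eta ≤ (geoCK i c).len (blkCubeY i c z) := by rw [← geoCK_eta i c]; exact geoCK_eta_le_len i c _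
  set x : ℝ := (kGeo i).eta * (α₁ * ((geoCK i c).len (blkCubeY i c z))⁻¹) with hxdef
  have hx0 : 0 ≤ x := mul_nonneg hη.le (mul_nonneg hα₁0 (inv_nonneg.2 hlen.le))
  have hx4 : x ≤ 1 / 4 := by
    have h1 : (kGeo i).eta * ((geoCK i c).len (blkCubeY i c z))⁻¹ ≤ 1 := by
      rw [← div_eq_mul_inv, div_le_one hlen]; exact hηlen
    calc x = α₁ * ((kGeo i).eta * ((geoCK i c).len (blkCubeY i c z))⁻¹) := by rw [hxdef]; ring
      _ ≤ α₁ * 1 := mul_le_mul_of_nonneg_left h1 hα₁0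
      _ ≤ 1 / 4 := by linarith
  set v := (boxEquiv i.hN).symm ((shiftY i μ).symm z) with hv
  have hW : UboxY i (locCfgY i c (kGeo i).eta A) μ ((shiftY i μ).symm z) = fluct (kGeo i).eta (cutFldY i (chiTY i c) A) μ v := by
    show locCfgY i c (kGeo i).eta A μ ((boxEquiv i.hN).symm ((shiftY i μ).symm z)) = _
    rw [locCfgY_apply]
  have hxA : (kGeo i).eta * ‖cutFldY i (chiTY i c) A μ v‖ ≤ x := by
    rw [hxdef]
    refine mul_le_mul_of_nonneg_left ?_ hη.le
    have h := hAτ μ μ z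
    rwa [B9Cor36CutoffField337.tauB_one_apply, chartA_apply] at h
  obtain ⟨h1, h2⟩ := B9Eq358TaxiLettersY.norm_fluct_sub_one_le i hη.le (cutFldY i (chiTY i c) A) μ v hxA hx4
  rw [mulDefB_apply, norm_smul, norm_inv, Complex.norm_real, Real.norm_eq_abs, abs_of_pos hη, hW]
  have h2' : ‖(((fluct (kGeo i).eta (cutFldY i (chiTY i c) A) μ v)⁻¹ : 𝔸ˣ) : 𝔸) - 1‖ ≤ 2 * x := h2
  have h1' : ‖((((fluct (kGeo i).eta (cutFldY i (chiTY i c) A) μ v)⁻¹)⁻¹ : 𝔸ˣ) : 𝔸) - 1‖ ≤ 2 * x := by rw [inv_inv]; exact h1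
  calc (kGeo i).eta⁻¹ * ‖R (fluct (kGeo i).eta (cutFldY i (chiTY i c) A) μ v)⁻¹ (f z) - f z‖
      ≤ (kGeo i).eta⁻¹ * (5 * x * ‖f z‖) := mul_le_mul_of_nonneg_left (norm_R_sub_self_le_of_small _ hx0 hx4 h2' h1' (f z)) (inv_nonneg.2 hη.le)
    _ = ((kGeo i).eta⁻¹ * (kGeo i).eta) * (5 * α₁ * ((geoCK i c).len (blkCubeY i c z))⁻¹ * ‖f z‖) := by rw [hxdef]; ring
    _ = 5 * α₁ * ((geoCK i c).len (blkCubeY i c z))⁻¹ * ‖f z‖ := by rw [inv_mul_cancel₀ hη.ne', one_mul]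

end Defect

/-! ## §3  Two rules of [4]'s majorant calculus: a source-weighted kernel followed by a one-step shift; the identity -/

section Rules

variable (i : KIdx d ℓ hd hL b₀ b₁) (c : ↥(cubes (toKT i).D.toDomains))

/-- ★ **WEIGHTED KERNEL ∘ SHIFT** (the right twin of FILE 5b's `hasMajorant_shift_mul_weighted`): `Y ≺ A·ℓ(a)²·e^{−δd(a,a′)}·r·ℓ(a′)⁻¹` (a source weight) and
`S ≺ e^{(1−α)δ}·e^{−(1−α)δd}`, with the scale transfer `e^{−αδd(a,e)}ℓ(e)⁻¹ ≤ Λℓ(a)⁻¹`, triangle, `d ≥ 0`, (2.61) at `((1−α)δ, α′)` ⟹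
`Y·S ≺ A·r·Λ·e^{(1−α)δ}·c₁²·ℓ(a)·e^{−(1−α′)(1−α)δd}`. [cite: Balaban1984PropagatorsII, (2.52)–(2.55) pp.232–233, (2.60)–(2.63) p.234; Balaban1985BackgroundPropagators, p.398 (scale transfer)] -/
theorem hasMajorant_weighted_mul_shift {X : Type} (Rr : ℝ) (H : Prop) (blk : X → BlkCubeY i c) (dB : ℕ) {δ α α' r A Λ : ℝ}
    (hr : 0 ≤ r) (hA : 0 ≤ A) (hΛ : 0 ≤ Λ) (hδ' : 0 ≤ (1 - α) * δ) (hα'1 : α' ≤ 1)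
    (htri : Triangle254 (toB6 (geoCK i c) Rr H))
    (hST : ∀ a e : BlkCubeY i c, Real.exp (-(α * δ * (geoCK i c).dist a e)) * ((geoCK i c).len e)⁻¹ ≤ Λ * ((geoCK i c).len a)⁻¹)
    (h261 : Ineq261 dB (toB6 (geoCK i c) Rr H) ((1 - α) * δ) α')
    {S Y : Module.End ℝ (X → ℝ)}
    (hY : HasMajorant (g := toB6 (geoCK i c) Rr H) blk Y
      (fun a a' => A * (geoCK i c).len a ^ 2 * Real.exp (-(δ * (geoCK i c).dist a a')) * (r * ((geoCK i c).len a')⁻¹)))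
    (hS : HasMajorant (g := toB6 (geoCK i c) Rr H) blk S
      (fun a a' => Real.exp ((1 - α) * δ) * Real.exp (-((1 - α) * δ * (geoCK i c).dist a a')))) :
    HasMajorant (g := toB6 (geoCK i c) Rr H) blk (Y * S)
      (fun a a' => A * r * Λ * Real.exp ((1 - α) * δ) * B6.c1 dB ((1 - α) * δ) α' ^ 2 * (geoCK i c).len a *
        Real.exp (-((1 - α') * ((1 - α) * δ) * (geoCK i c).dist a a'))) := by
  have hdnn := (geoCK_dist_axioms i c Rr H).1
  have hlen0 : ∀ a : BlkCubeY i c, 0 ≤ (geoCK i c).len a := fun a => (geoCK_len_pos i c a).le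
  have hK₂ : ∀ a a' : BlkCubeY i c, 0 ≤ Real.exp ((1 - α) * δ) * Real.exp (-((1 - α) * δ * (geoCK i c).dist a a')) := fun a a' =>
    mul_nonneg (Real.exp_nonneg _) (Real.exp_nonneg _)
  have h263 := B6RandomWalk.ineq263_of_261 dB (toB6 (geoCK i c) Rr H) ((1 - α) * δ) α' htri hδ' hα'1 h261 1
  refine hasMajorant_mono (g := toB6 (geoCK i c) Rr H) _ (B6RandomWalk.hasMajorant_mul (g := toB6 (geoCK i c) Rr H) blk hY hS hK₂) fun a a'' => ?_
  have hterm : ∀ e : BlkCubeY i c,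
      A * (geoCK i c).len a ^ 2 * Real.exp (-(δ * (geoCK i c).dist a e)) * (r * ((geoCK i c).len e)⁻¹) *
          (Real.exp ((1 - α) * δ) * Real.exp (-((1 - α) * δ * (geoCK i c).dist e a''))) ≤
        A * r * Λ * Real.exp ((1 - α) * δ) * (geoCK i c).len a *
          (Real.exp (-((1 - α) * δ * (geoCK i c).dist a e)) * Real.exp (-((1 - α) * δ * (geoCK i c).dist e a''))) := by
    intro e
    have hsplit : Real.exp (-(δ * (geoCK i c).dist a e)) = Real.exp (-(α * δ * (geoCK i c).dist a e)) * Real.exp (-((1 - α) * δ * (geoCK i c).dist a e)) := by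
      rw [← Real.exp_add]; ring_nf
    have h1 := hST a e
    have hl2 : (geoCK i c).len a ^ 2 * (Λ * ((geoCK i c).len a)⁻¹) = Λ * (geoCK i c).len a := by
      have := (geoCK_len_pos i c a).ne'
      field_simp
    have hpre : 0 ≤ A * r * Real.exp ((1 - α) * δ) * Real.exp (-((1 - α) * δ * (geoCK i c).dist a e)) * Real.exp (-((1 - α) * δ * (geoCK i c).dist e a'')) :=
      mul_nonneg (mul_nonneg (mul_nonneg (mul_nonneg hA hr) (Real.exp_nonneg _)) (Real.exp_nonneg _)) (Real.exp_nonneg _)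
    calc A * (geoCK i c).len a ^ 2 * Real.exp (-(δ * (geoCK i c).dist a e)) * (r * ((geoCK i c).len e)⁻¹) *
          (Real.exp ((1 - α) * δ) * Real.exp (-((1 - α) * δ * (geoCK i c).dist e a'')))
        = (A * r * Real.exp ((1 - α) * δ) * Real.exp (-((1 - α) * δ * (geoCK i c).dist a e)) * Real.exp (-((1 - α) * δ * (geoCK i c).dist e a''))) *
          ((geoCK i c).len a ^ 2 * (Real.exp (-(α * δ * (geoCK i c).dist a e)) * ((geoCK i c).len e)⁻¹)) := by rw [hsplit]; ring
      _ ≤ (A * r * Real.exp ((1 - α) * δ) * Real.exp (-((1 - α) * δ * (geoCK i c).dist a e)) * Real.exp (-((1 - α) * δ * (geoCK i c).dist e a''))) *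
          ((geoCK i c).len a ^ 2 * (Λ * ((geoCK i c).len a)⁻¹)) :=
          mul_le_mul_of_nonneg_left (mul_le_mul_of_nonneg_left h1 (sq_nonneg _)) hpre
      _ = _ := by rw [hl2]; ring
  have hchain := h263 a a''
  simp only [B6RandomWalk.chain] at hchain
  have hpre2 : 0 ≤ A * r * Λ * Real.exp ((1 - α) * δ) * (geoCK i c).len a :=
    mul_nonneg (mul_nonneg (mul_nonneg (mul_nonneg hA hr) hΛ) (Real.exp_nonneg _)) (hlen0 a)
  calc ∑ e, A * (geoCK i c).len a ^ 2 * Real.exp (-(δ * (geoCK i c).dist a e)) * (r * ((geoCK i c).len e)⁻¹) *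
          (Real.exp ((1 - α) * δ) * Real.exp (-((1 - α) * δ * (geoCK i c).dist e a'')))
      ≤ ∑ e, A * r * Λ * Real.exp ((1 - α) * δ) * (geoCK i c).len a *
          (Real.exp (-((1 - α) * δ * (geoCK i c).dist a e)) * Real.exp (-((1 - α) * δ * (geoCK i c).dist e a''))) := Finset.sum_le_sum fun e _ => hterm e
    _ = A * r * Λ * Real.exp ((1 - α) * δ) * (geoCK i c).len a *
          ∑ e, Real.exp (-((1 - α) * δ * (geoCK i c).dist a e)) * Real.exp (-((1 - α) * δ * (geoCK i c).dist e a'')) := by rw [Finset.mul_sum]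
    _ ≤ A * r * Λ * Real.exp ((1 - α) * δ) * (geoCK i c).len a *
          (B6.c1 dB ((1 - α) * δ) α' ^ (1 + 1) * Real.exp (-((1 - α') * ((1 - α) * δ) * (geoCK i c).dist a a''))) :=
        mul_le_mul_of_nonneg_left hchain hpre2
    _ = _ := by ring

/-- the identity has the majorant `e^{−δd}` (it reads and writes the same block; `d(a,a) = 0`). [cite: Balaban1984PropagatorsII, (2.51) p.232, bookkeeping] -/
theorem hasMajorant_one_decay {X : Type} (Rr : ℝ) (H : Prop) (blk : X → BlkCubeY i c) (δ : ℝ) :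
    HasMajorant (g := toB6 (geoCK i c) Rr H) blk (1 : Module.End ℝ (X → ℝ)) (fun a a' => Real.exp (-(δ * (geoCK i c).dist a a'))) := by
  intro y' μ B hμ x
  beta_reduce
  rw [Module.End.one_apply]
  by_cases hx : blk x = y'
  · have h0 : (geoCK i c).dist (blk x) y' = 0 := by rw [hx]; exact (geoCK_dist_axioms i c Rr H).2.2.1 y'
    rw [h0, mul_zero, neg_zero, Real.exp_zero, one_mul]
    exact hμ.bound x hx
  · rw [hμ.off x hx, abs_zero]
    exact mul_nonneg (Real.exp_nonneg _) hμ.nonneg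

end Rules

/-! ## §4  The averaging term of `Δ′_{a,□}(Ṽ_□)` is a block-local letter of size `(1 + C_qα₁)²(Lⁿη)⁻²`; `η⁻²Δ_{Ṽ}` in the letters -/

section Avg

variable (i : KIdx d ℓ hd hL b₀ b₁) (c : ↥(cubes (toKT i).D.toDomains)) (b : Module.Basis ι ℝ 𝔸)

/-- ★ **THE AVERAGING TERM `η⁻²Σ a_n(Lⁿη)⁻²Q′*_□(Ṽ)Q′_□(Ṽ)` IS BLOCK-LOCAL OF SIZE `(1 + C_qα₁)²·(Lⁿη)⁻²`**: FILE 1's word form `L[sQ(Ṽ)]·diag(c_□)·K[kQ(Ṽ)]`,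
`kQ(Ṽ) = kQ(1) + kF`, `sQ(Ṽ) = sQ(1) + sF` with the (3.19) sizes at `U = 1` and the (3.59) sizes of `kF`, `sF`, `#block·w ≤ 1`, `|η⁻²c_□(s)| ≤ (L^{n(s)}η)⁻²`.
[cite: Balaban1985BackgroundPropagators, (3.24) p.394, (3.19) p.393, (3.57)–(3.59) pp.401–402, p.409; Balaban1984PropagatorsII, (2.14) p.225] -/
theorem norm_avgCube_apply_le (par : SiteParY 𝔸 i) (h1 : ‖(1 : 𝔸)‖ ≤ 1) (hpar : ∀ z w, par (fun _ _ => 1) z w = 1) (V : CfgY 𝔸 i)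
    {Cq α₁ : ℝ} (hCq : 0 ≤ Cq) (hα : 0 ≤ α₁)
    (hkF : ∀ (y : BlkCubeY i c) (x : SiteY i), blkCubeY i c x = y → ‖kFCubeY i c par (fun _ _ => 1) V y x‖ ≤ Cq * α₁ * wK i c y)
    (hsF : ∀ x : SiteY i, ‖sFCubeY i c par (fun _ _ => 1) V x‖ ≤ Cq * α₁)
    (f : SiteY i → 𝔸) (z : SiteY i) (Bf : ℝ) (hBf : ∀ x', blkCubeY i c x' = blkCubeY i c z → ‖f x'‖ ≤ Bf) :
    ‖((((kGeo i).eta ^ 2)⁻¹ : ℝ) • (kernelTrOpY (avgCoeffCubeY i c) (avgTrCubeY i c par V)).restrictScalars ℝ) f z‖ ≤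
      (1 + Cq * α₁) ^ 2 * ((geoCK i c).len (blkCubeY i c z) ^ 2)⁻¹ * Bf := by
  have hη : 0 < (kGeo i).eta := by rw [← geoCK_eta i c]; exact geoCK_eta_pos i c
  have hBf0 : 0 ≤ Bf := (norm_nonneg _).trans (hBf z rfl)
  set s := blkCubeY i c z with hs
  -- the word form and the one-word size
  have hword : ((kernelTrOpY (avgCoeffCubeY i c) (avgTrCubeY i c par V)).restrictScalars ℝ) f z =
      sQCubeY i c par V z (cCubeY i c s • kerOp (blkCubeY i c) (kQCubeY i c par V) f s) := by
    rw [avgTermCube_eq_word]; rfl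
  have hσ : ‖sQCubeY i c par V z‖ ≤ 1 + Cq * α₁ := by
    have e : sQCubeY i c par V z = sQCubeY i c par (fun _ _ => 1) z + sFCubeY i c par (fun _ _ => 1) V z := by
      simp [sFCubeY]
    rw [e]; exact (norm_add_le _ _).trans (add_le_add (norm_sQCubeY_one_le i c par h1 hpar z) (hsF z))
  have hκ : ∀ x', blkCubeY i c x' = blkCubeY i c z → ‖kQCubeY i c par V (blkCubeY i c z) x'‖ ≤ (1 + Cq * α₁) * wK i c s := fun x' hx' => by
    have e : kQCubeY i c par V s x' = kQCubeY i c par (fun _ _ => 1) s x' + kFCubeY i c par (fun _ _ => 1) V s x' := by simp [kFCubeY]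
    rw [← hs, e]
    calc ‖kQCubeY i c par (fun _ _ => 1) s x' + kFCubeY i c par (fun _ _ => 1) V s x'‖
        ≤ wK i c s + Cq * α₁ * wK i c s := (norm_add_le _ _).trans (add_le_add (norm_kQCubeY_one_le i c par h1 hpar s x') (hkF s x' (hx'.trans hs.symm)))
      _ = (1 + Cq * α₁) * wK i c s := by ring
  have hκ0 : 0 ≤ (1 + Cq * α₁) * wK i c s := mul_nonneg (by positivity) (wK_nonneg i c s)
  have hst := norm_starTerm_le (blkCubeY i c) (sQCubeY i c par V) (kQCubeY i c par V) (cCubeY i c) f z hσ hκ0 hκ hBf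
  rw [← hs] at hst
  -- `|η⁻²c_□(s)|·#block·w(s) ≤ (Lⁿη)⁻²`
  have hcw : ((kGeo i).eta ^ 2)⁻¹ * |cCubeY i c s| * (((B9Eq360Vprime.block (blkCubeY i c) s).card : ℝ) * wK i c s) ≤ ((geoCK i c).len s ^ 2)⁻¹ := by
    have hcf : ((kGeo i).eta ^ 2)⁻¹ * |cCubeY i c s| = |cfunK i c s| := by
      rw [cfunK, abs_mul, abs_of_pos (inv_pos.2 (pow_pos hη 2))]
    rw [hcf]
    calc |cfunK i c s| * (((B9Eq360Vprime.block (blkCubeY i c) s).card : ℝ) * wK i c s) ≤ |cfunK i c s| * 1 :=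
          mul_le_mul_of_nonneg_left (card_block_mul_wK_le i c s) (abs_nonneg _)
      _ ≤ ((geoCK i c).len s ^ 2)⁻¹ := by rw [mul_one]; have := abs_cfunK_le i c s; rwa [one_mul] at this
  rw [LinearMap.smul_apply, Pi.smul_apply, norm_smul, Real.norm_eq_abs, abs_of_pos (inv_pos.2 (pow_pos hη 2)), hword]
  calc ((kGeo i).eta ^ 2)⁻¹ * ‖sQCubeY i c par V z (cCubeY i c s • kerOp (blkCubeY i c) (kQCubeY i c par V) f s)‖
      ≤ ((kGeo i).eta ^ 2)⁻¹ * ((1 + Cq * α₁) * (|cCubeY i c s| * (((B9Eq360Vprime.block (blkCubeY i c) s).card : ℝ) * ((1 + Cq * α₁) * wK i c s) * Bf))) :=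
        mul_le_mul_of_nonneg_left hst (inv_nonneg.2 (sq_nonneg _))
    _ = (1 + Cq * α₁) ^ 2 * (((kGeo i).eta ^ 2)⁻¹ * |cCubeY i c s| * (((B9Eq360Vprime.block (blkCubeY i c) s).card : ℝ) * wK i c s)) * Bf := by ring
    _ ≤ (1 + Cq * α₁) ^ 2 * ((geoCK i c).len s ^ 2)⁻¹ * Bf :=
        mul_le_mul_of_nonneg_right (mul_le_mul_of_nonneg_left hcw (sq_nonneg _)) hBf0

/-- `η⁻²Δ_{V} = η⁻²Δ′_{a,□}(V) − η⁻²(averaging term)` in the letters (r05's definition of `Δ′_{a,□}`). [cite: Balaban1985BackgroundPropagators, (3.24) p.394, p.409] -/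
theorem smul_lapSL_eq (par : SiteParY 𝔸 i) (V : CfgY 𝔸 i) (r : ℝ) :
    r • (lapSL i V).restrictScalars ℝ =
      r • (deltaPrimeACubeY i c par V).restrictScalars ℝ - r • (kernelTrOpY (avgCoeffCubeY i c) (avgTrCubeY i c par V)).restrictScalars ℝ := by
  refine LinearMap.ext fun f => ?_
  simp only [LinearMap.smul_apply, LinearMap.sub_apply, LinearMap.restrictScalars_apply, deltaPrimeACubeY, LinearMap.add_apply, smul_add,
    add_sub_cancel_right]

end Avg

/-! ## §5  ★★★ The four (3.42) entries of `G′_□(Ṽ_□)` with the derivatives at `Ṽ_□`, over the cube sequence's blocks -/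

section Main

variable (b : Module.Basis ι ℝ 𝔸)

omit [CompleteSpace 𝔸] in
/-- `conj b` adds. [cite: Balaban1984PropagatorsII, (2.51) p.232, bookkeeping] -/
theorem conj_add' {S : Type} (T₁ T₂ : Module.End ℝ (S → 𝔸)) : conj b (T₁ + T₂) = conj b T₁ + conj b T₂ := map_add (coordEquiv b).conj T₁ T₂

variable [NormOneClass 𝔸] [DecidableEq ι]

set_option maxHeartbeats 1600000 in
/-- ★★★ **COROLLARY 3.6 AT ONE COVER CUBE — THE FOUR (3.42) ENTRIES OF `G′_□(Ṽ_□)` WITH THE DERIVATIVES AT `Ṽ_□`, OVER THE CUBE SEQUENCE's BLOCKS**, uniformly in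
the member and the cube: there are `δ > 0`, `B_f ≥ 0`, thresholds `M₀, T₀, N₀` and Theorem 3.4's `a₁ > 0` (functions of `d, L`, the basis datum `M₂, Σ‖b_j‖`) such
that for every member above the thresholds, every cover cube `□`, all letters `Rr, H` and every (3.35) cube datum as in FILE 7a with `α₁ := max C (C(1+D₁θ))Λ² ≤
min(a₁, 1/4)`: `Δ′_{a,□}(Ṽ_□)` is a unit and, with `G := conj b(η²G′_□(Ṽ_□))`, `∇_k := conj b(diffLetter Ṽ_□ η⁻¹ k)`, `L := conj b(η⁻²Δ_{Ṽ_□})`: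
`G ≺ B_f(Lⁿη)²e^{−δd}`, `∇_k·G ≺ B_fLⁿηe^{−δd}` (all `k ∈ κ ⊕ κ`), `G·(−∇*_μ) ≺ B_fLⁿηe^{−δd}`, `L·G ≺ B_f·1·e^{−δd}` — print's (3.42) for `G′_□(U)` at the
localised field, in [4]'s block-majorant form. [cite: Balaban1985BackgroundPropagators, Cor. 3.6 p.408 l.1–10, Thm 3.1 (3.42) p.397, Thm 3.4 p.400, p.403 l.1–9, (3.24)–(3.25) p.394, p.409 l.1–5; Balaban1984PropagatorsII, (2.51)–(2.55) p.232, Lemma 2.1 p.234] -/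
theorem gp_cube_entries_at_locCfg (d ℓ : ℕ) (hℓ : 1 ≤ ℓ) (M₂ : ℝ) (hM₂ : 0 ≤ M₂) (hrepr : ∀ (v : 𝔸) (j : ι), |b.repr v j| ≤ M₂ * ‖v‖) :
    ∃ δ Bf M₀ T₀ : ℝ, ∃ N₀ : ℕ, 0 < δ ∧ 0 ≤ Bf ∧ ∃ a₁ : ℝ, 0 < a₁ ∧
    ∀ {hd : 1 ≤ d + 1} {hL : Odd (ℓ + 1) ∧ 1 < ℓ + 1} {b₀ b₁ : ℝ} (i : KIdx d ℓ hd hL b₀ b₁) (c : ↥(cubes (toKT i).D.toDomains)) (Rr : ℝ) (H : Prop),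
      M₀ ≤ ((ℓ : ℝ) + 1) * (toKT i).Mh → N₀ + 1 ≤ (toKT i).R * ((ℓ + 1) * (toKT i).Mh) → T₀ ≤ RM1 i →
    ∀ (g : GaugeY 𝔸 i) (U : CfgY 𝔸 i) (A : AfldY 𝔸 i) (Q : Set (Site (PV d ℓ i.m i.K hd hL) 0)) (C ξ Λ : ℝ),
      0 ≤ C → 0 < ξ → 1 ≤ Λ → ξ ≤ 5 * (SC i c : ℝ) * (kGeo i).eta → LatticeNorms.scaleLen ((ℓ : ℝ) + 1) (kGeo i).eta (c.1.1 + 1) ≤ Λ * ξ →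
      (∀ x : Site (PV d ℓ i.m i.K hd hL) 0, NearC i c (35 * SC i c / 8 + 1) (boxEquiv i.hN x).1 → x ∈ Q) →
      (∀ (κ : Fin (d + 1)) (x : Site (PV d ℓ i.m i.K hd hL) 0), x ∈ Q → x.shift κ ∈ Q → gaugeY i g U κ x = fluct (kGeo i).eta A κ x) →
      (∀ κ, ∀ x ∈ Q, ‖A κ x‖ ≤ C * ξ⁻¹) →
      (∀ μ ν, ∀ x ∈ Q, ‖(((kGeo i).eta : ℂ)⁻¹) • covD (shiftsV1 (PV d ℓ i.m i.K hd hL)) (fun _ _ => (1 : 𝔸ˣ)) μ (A ν) x‖ ≤ C * (ξ ^ 2)⁻¹) →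
      max C (C * (1 + D1 thetaProf)) * Λ ^ 2 ≤ a₁ → max C (C * (1 + D1 thetaProf)) * Λ ^ 2 ≤ 1 / 4 →
      IsUnit (deltaPrimeACubeY i c (parSymY i) (locCfgY i c (kGeo i).eta A)) ∧
      HasMajorant (g := toB6 (geoCK i c) Rr H) (fun p : SiteY i × ι => blkCubeY i c p.1) (GpVK b i c (parSymY i) A)
        (fun a a' => Bf * (geoCK i c).len a ^ 2 * Real.exp (-(δ * (geoCK i c).dist a a'))) ∧
      (∀ k : Fin (d + 1) ⊕ Fin (d + 1), HasMajorant (g := toB6 (geoCK i c) Rr H) (fun p : SiteY i × ι => blkCubeY i c p.1)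
        (conj b (diffLetter (shiftY i) (UboxY i (locCfgY i c (kGeo i).eta A)) ((((kGeo i).eta : ℂ))⁻¹) k) * GpVK b i c (parSymY i) A)
        (fun a a' => Bf * (geoCK i c).len a * Real.exp (-(δ * (geoCK i c).dist a a')))) ∧
      (∀ μ : Fin (d + 1), HasMajorant (g := toB6 (geoCK i c) Rr H) (fun p : SiteY i × ι => blkCubeY i c p.1)
        (GpVK b i c (parSymY i) A * conj b (diffLetter (shiftY i) (UboxY i (locCfgY i c (kGeo i).eta A)) ((((kGeo i).eta : ℂ))⁻¹) (Sum.inr μ)))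
        (fun a a' => Bf * (geoCK i c).len a * Real.exp (-(δ * (geoCK i c).dist a a')))) ∧
      HasMajorant (g := toB6 (geoCK i c) Rr H) (fun p : SiteY i × ι => blkCubeY i c p.1)
        (conj b ((((kGeo i).eta ^ 2)⁻¹ : ℝ) • (lapSL i (locCfgY i c (kGeo i).eta A)).restrictScalars ℝ) * GpVK b i c (parSymY i) A)
        (fun a a' => Bf * 1 * Real.exp (-(δ * (geoCK i c).dist a a'))) := by
  have h1A : ‖(1 : 𝔸)‖ ≤ 1 := norm_one.le
  have hSb : 0 ≤ ∑ j, ‖b j‖ := Finset.sum_nonneg fun _ _ => norm_nonneg _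
  obtain ⟨δ₀, BG, M₀, T₀, N₀, hδ₀, hBG, a₁, ha₁, B, hB, Hm⟩ := gp_cube_at_locCfg b d ℓ hℓ M₂ hM₂ hrepr
  -- the rates: transferred entries at `δ′ = (9/10)δ₀`, shift corrections at `ρ′ = (1 − 1/20)·ρ`, `ρ = (1 − 1/20)δ′`; final `δ_f = (4/5)δ₀`
  set δ' : ℝ := 9 / 10 * δ₀ with hδ'def
  set ρ : ℝ := (1 - 1 / 20) * (9 / 10 * δ₀) with hρdef
  have hδ' : 0 < δ' := by rw [hδ'def]; positivity
  have hρ : 0 < ρ := by rw [hρdef]; positivity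
  obtain ⟨dB, h261⟩ := exists_h261_geoCK d ℓ hρ
  set cB : ℝ := B6.c1 dB ρ (1 / 20) with hcBdef
  have hcB : 0 ≤ cB := c1_nonneg _ _ _
  set Λ4 : ℝ := ((ℓ : ℝ) + 1) ^ 4 with hΛ4def
  have hΛ4 : 0 ≤ Λ4 := by positivity
  -- the constants (with `α₁ ≤ 1/4` absorbed)
  set K₂ : ℝ := 5 / 4 * (M₂ * ∑ j, ‖b j‖) * (Real.exp δ' * B * Λ4 * cB ^ 2) with hK₂def
  set K₃ : ℝ := B * (5 / 4 * (M₂ * ∑ j, ‖b j‖)) * Λ4 * Real.exp ρ * cB ^ 2 with hK₃def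
  set K₄ : ℝ := 1 + (1 + Cq d * (1 / 4)) ^ 2 * (M₂ * ∑ j, ‖b j‖) * B with hK₄def
  have hK₂ : 0 ≤ K₂ := by rw [hK₂def]; positivity
  have hK₃ : 0 ≤ K₃ := by rw [hK₃def]; positivity
  have hK₄ : 0 ≤ K₄ := by rw [hK₄def]; have := Cq_nonneg d; positivity
  set Bf : ℝ := B + K₂ + K₃ + K₄ with hBfdef
  have hBf : 0 ≤ Bf := by rw [hBfdef]; positivity
  refine ⟨4 / 5 * δ₀, Bf, M₀, T₀, max N₀ (N1 d ℓ (9 / 5000 * ρ)), by positivity, hBf, a₁, ha₁, ?_⟩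
  intro hd hL b₀ b₁ i c Rr H hM hN hT g U A Q C ξ Λ hC hξ hΛ hξS hΛξ hQ hgA hA hdA hα₁ hα4
  have hN₀ : N₀ + 1 ≤ (toKT i).R * ((ℓ + 1) * (toKT i).Mh) := le_trans (Nat.succ_le_succ (le_max_left _ _)) hN
  have hNρ : N1 d ℓ (9 / 5000 * ρ) + 1 ≤ (toKT i).R * ((ℓ + 1) * (toKT i).Mh) := le_trans (Nat.succ_le_succ (le_max_right _ _)) hN
  obtain ⟨⟨hunit, -⟩, ⟨hT1, -⟩, ⟨hbase, hL0, hR0⟩, ⟨r4, r5, hkF, hsF⟩, HX, HY⟩ :=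
    Hm i c Rr H hM hN₀ hT g U A Q C ξ Λ hC hξ hΛ hξS hΛξ hQ hgA hA hdA hα₁ hα4
  set α₁ : ℝ := max C (C * (1 + D1 thetaProf)) * Λ ^ 2 with hα₁def
  have hα₁0 : 0 ≤ α₁ := by rw [hα₁def]; exact mul_nonneg (le_max_of_le_left hC) (sq_nonneg _)
  set η : ℝ := (kGeo i).eta with hηdef
  set V := locCfgY i c η A with hVdef
  set G := GpVK b i c (parSymY i) A with hGdef
  haveI : Nonempty (geoCK i c).Site := geoCK_site_nonempty i c
  obtain ⟨hdnn, htri, hrefl, hsym⟩ := geoCK_dist_axioms i c Rr H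
  have hlen0 : ∀ a : BlkCubeY i c, 0 ≤ (geoCK i c).len a := fun a => (geoCK_len_pos i c a).le
  have hpow1 : ∀ a : BlkCubeY i c, 0 ≤ (geoCK i c).len a := hlen0
  have hpow2 : ∀ a : BlkCubeY i c, 0 ≤ (geoCK i c).len a ^ 2 := fun a => sq_nonneg _
  -- (0) `G ≺ B·len²·e^{−δ′d}`
  have hG : HasMajorant (g := toB6 (geoCK i c) Rr H) (fun p : SiteY i × ι => blkCubeY i c p.1) G
      (fun a a' => B * (geoCK i c).len a ^ 2 * Real.exp (-(δ' * (geoCK i c).dist a a'))) :=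
    B9Cor36GpCubeExtAtV.hasMajorant_GpVK b i c Rr H A hbase HX
  -- the base-derived derivative entries at `δ′`
  have hL1 : ∀ k, HasMajorant (g := toB6 (geoCK i c) Rr H) (fun p : SiteY i × ι => blkCubeY i c p.1)
      (conj b (diffLetter (shiftY i) (fun _ _ => (1 : 𝔸ˣ)) (((η : ℂ))⁻¹) k) * G)
      (fun a a' => B * (geoCK i c).len a * Real.exp (-(δ' * (geoCK i c).dist a a'))) :=
    fun k => HX _ (fun a => (geoCK i c).len a) hlen0 (hL0 k)
  have hR1 : ∀ k, HasMajorant (g := toB6 (geoCK i c) Rr H) (fun p : SiteY i × ι => blkCubeY i c p.1)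
      (G * conj b (diffLetter (shiftY i) (fun _ _ => (1 : 𝔸ˣ)) (((η : ℂ))⁻¹) k))
      (fun a a' => B * (geoCK i c).len a * Real.exp (-(δ' * (geoCK i c).dist a a'))) :=
    fun k => HY _ (hR0 k)
  -- the scale transfers at `δ′` with exponent `1/20` (= FILE 5a's at `δ₀` with exponent `9/200`)
  have hconv : ∀ t : ℝ, -(1 / 20 * (9 / 10 * δ₀) * t) = -(9 / 200 * δ₀ * t) := fun t => by ring
  obtain ⟨-, hST2, hST3, -, -, -⟩ := hST_geoCK i c hδ₀ hT1 (9 / 200) (by norm_num)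
  have hPΛ : ∀ a e : BlkCubeY i c, Real.exp (-(1 / 20 * δ' * (geoCK i c).dist a e)) * (geoCK i c).len e ^ 2 ≤ Λ4 * (geoCK i c).len a ^ 2 :=
    fun a e => by rw [hδ'def, hconv]; exact hST2 a e
  have hPΛ' : ∀ a e : BlkCubeY i c, Real.exp (-(1 / 20 * δ' * (geoCK i c).dist a e)) * ((geoCK i c).len e)⁻¹ ≤ Λ4 * ((geoCK i c).len a)⁻¹ :=
    fun a e => by rw [hδ'def, hconv]; exact hST3 a e
  have h261ρ : Ineq261 dB (toB6 (geoCK i c) Rr H) ((1 - 1 / 20) * δ') (1 / 20) := h261 i c Rr H hNρ (1 / 20) (by norm_num) (by norm_num)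
  have hαδ : 0 ≤ 1 / 20 * δ' := by positivity
  have hρ' : 0 ≤ (1 - 1 / 20) * δ' := by rw [hδ'def]; positivity
  -- the defect multipliers are row-local
  have hα1 : α₁ ≤ 1 / 4 := hα4
  have hcF : ∀ a : BlkCubeY i c, 0 ≤ 5 * α₁ * ((geoCK i c).len a)⁻¹ := fun a => mul_nonneg (by positivity) (inv_nonneg.2 (hlen0 a))
  have hlocF : ∀ μ, ∀ (w : SiteY i × ι → ℝ) (p : SiteY i × ι) (Mb : ℝ), (∀ p' : SiteY i × ι, blkCubeY i c p'.1 = blkCubeY i c p.1 → |w p'| ≤ Mb) →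
      |conj b (mulDefF i V (((η : ℂ))⁻¹) μ) w p| ≤ 5 * α₁ * ((geoCK i c).len (blkCubeY i c p.1))⁻¹ * (M₂ * ∑ j, ‖b j‖) * Mb :=
    fun μ => rowLocal_conj_of_local b (blkCubeY i c) (fun a => 5 * α₁ * ((geoCK i c).len a)⁻¹) hM₂ hrepr _ fun f x Bf' hBf' =>
      (norm_mulDefF_apply_le i c A hα₁0 hα1 r4 μ f x).trans (mul_le_mul_of_nonneg_left (hBf' x rfl) (hcF _))
  have hlocB : ∀ μ, ∀ (w : SiteY i × ι → ℝ) (p : SiteY i × ι) (Mb : ℝ), (∀ p' : SiteY i × ι, blkCubeY i c p'.1 = blkCubeY i c p.1 → |w p'| ≤ Mb) →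
      |conj b (mulDefB i V (((η : ℂ))⁻¹) μ) w p| ≤ 5 * α₁ * ((geoCK i c).len (blkCubeY i c p.1))⁻¹ * (M₂ * ∑ j, ‖b j‖) * Mb :=
    fun μ => rowLocal_conj_of_local b (blkCubeY i c) (fun a => 5 * α₁ * ((geoCK i c).len a)⁻¹) hM₂ hrepr _ fun f x Bf' hBf' =>
      (norm_mulDefB_apply_le i c A hα₁0 hα1 r5 μ f x).trans (mul_le_mul_of_nonneg_left (hBf' x rfl) (hcF _))
  -- (1) LEFT CORRECTIONS: `conj b(mulDef)·(conj b(σ)·G)`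
  have hshiftG : ∀ μ, HasMajorant (g := toB6 (geoCK i c) Rr H) (fun p : SiteY i × ι => blkCubeY i c p.1)
      (conj b ((shiftOpY (𝔸 := 𝔸) i μ).restrictScalars ℝ) * G)
      (fun a a' => Real.exp δ' * B * Λ4 * cB ^ 2 * (geoCK i c).len a ^ 2 * Real.exp (-((1 - 1 / 20) * ((1 - 1 / 20) * δ') * (geoCK i c).dist a a'))) :=
    fun μ => hasMajorant_shift_mul_weighted i c Rr H (fun p : SiteY i × ι => blkCubeY i c p.1) dB (fun a => (geoCK i c).len a ^ 2)
      (Real.exp_nonneg _) hB hΛ4 hpow2 hαδ hρ' (by norm_num) htri hPΛ h261ρ (hasMajorant_conj_shiftOpY i c b Rr H hδ'.le μ) hG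
  have hshiftG' : ∀ μ, HasMajorant (g := toB6 (geoCK i c) Rr H) (fun p : SiteY i × ι => blkCubeY i c p.1)
      (conj b ((shiftOpY' (𝔸 := 𝔸) i μ).restrictScalars ℝ) * G)
      (fun a a' => Real.exp δ' * B * Λ4 * cB ^ 2 * (geoCK i c).len a ^ 2 * Real.exp (-((1 - 1 / 20) * ((1 - 1 / 20) * δ') * (geoCK i c).dist a a'))) :=
    fun μ => hasMajorant_shift_mul_weighted i c Rr H (fun p : SiteY i × ι => blkCubeY i c p.1) dB (fun a => (geoCK i c).len a ^ 2)
      (Real.exp_nonneg _) hB hΛ4 hpow2 hαδ hρ' (by norm_num) htri hPΛ h261ρ (hasMajorant_conj_shiftOpY' i c b Rr H hδ'.le μ) hG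
  have hcorrL : ∀ k, HasMajorant (g := toB6 (geoCK i c) Rr H) (fun p : SiteY i × ι => blkCubeY i c p.1)
      ((conj b (diffLetter (shiftY i) (UboxY i V) (((η : ℂ))⁻¹) k) - conj b (diffLetter (shiftY i) (fun _ _ => (1 : 𝔸ˣ)) (((η : ℂ))⁻¹) k)) * G)
      (fun a a' => K₂ * (geoCK i c).len a * Real.exp (-((1 - 1 / 20) * ((1 - 1 / 20) * δ') * (geoCK i c).dist a a'))) := by
    have hresh : ∀ a a' : BlkCubeY i c,
        5 * α₁ * ((geoCK i c).len a)⁻¹ * (M₂ * ∑ j, ‖b j‖) *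
            (Real.exp δ' * B * Λ4 * cB ^ 2 * (geoCK i c).len a ^ 2 * Real.exp (-((1 - 1 / 20) * ((1 - 1 / 20) * δ') * (geoCK i c).dist a a'))) ≤
          K₂ * (geoCK i c).len a * Real.exp (-((1 - 1 / 20) * ((1 - 1 / 20) * δ') * (geoCK i c).dist a a')) := by
      intro a a'
      have hl := geoCK_len_pos i c a
      have e : ((geoCK i c).len a)⁻¹ * (geoCK i c).len a ^ 2 = (geoCK i c).len a := by field_simp
      calc 5 * α₁ * ((geoCK i c).len a)⁻¹ * (M₂ * ∑ j, ‖b j‖) *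
            (Real.exp δ' * B * Λ4 * cB ^ 2 * (geoCK i c).len a ^ 2 * Real.exp (-((1 - 1 / 20) * ((1 - 1 / 20) * δ') * (geoCK i c).dist a a')))
          = 5 * α₁ * (M₂ * ∑ j, ‖b j‖) * (Real.exp δ' * B * Λ4 * cB ^ 2) * (((geoCK i c).len a)⁻¹ * (geoCK i c).len a ^ 2) *
            Real.exp (-((1 - 1 / 20) * ((1 - 1 / 20) * δ') * (geoCK i c).dist a a')) := by ring
        _ ≤ 5 / 4 * (M₂ * ∑ j, ‖b j‖) * (Real.exp δ' * B * Λ4 * cB ^ 2) * (((geoCK i c).len a)⁻¹ * (geoCK i c).len a ^ 2) *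
            Real.exp (-((1 - 1 / 20) * ((1 - 1 / 20) * δ') * (geoCK i c).dist a a')) := by
            have h54 : 5 * α₁ ≤ 5 / 4 := by linarith
            have hrest : 0 ≤ (M₂ * ∑ j, ‖b j‖) * (Real.exp δ' * B * Λ4 * cB ^ 2) * (((geoCK i c).len a)⁻¹ * (geoCK i c).len a ^ 2) *
                Real.exp (-((1 - 1 / 20) * ((1 - 1 / 20) * δ') * (geoCK i c).dist a a')) := by
              rw [e]; positivity
            nlinarith
        _ = _ := by rw [e, hK₂def]
    rintro (μ | μ)
    · have e : (conj b (diffLetter (shiftY i) (UboxY i V) (((η : ℂ))⁻¹) (Sum.inl μ)) -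
            conj b (diffLetter (shiftY i) (fun _ _ => (1 : 𝔸ˣ)) (((η : ℂ))⁻¹) (Sum.inl μ))) * G =
          conj b (mulDefF i V (((η : ℂ))⁻¹) μ) * (conj b ((shiftOpY (𝔸 := 𝔸) i μ).restrictScalars ℝ) * G) := by
        rw [diffLetter_inl_eq_add, conj_add', add_sub_cancel_left, B9Eq352DivFormLetters.conj_mul, mul_assoc]
      rw [e]
      exact hasMajorant_mono (g := toB6 (geoCK i c) Rr H) _ (hasMajorant_mul_of_rowLocal (g := toB6 (geoCK i c) Rr H)
        (fun p : SiteY i × ι => blkCubeY i c p.1) (fun a => 5 * α₁ * ((geoCK i c).len a)⁻¹ * (M₂ * ∑ j, ‖b j‖)) (hlocF μ) (hshiftG μ)) hresh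
    · have e : (conj b (diffLetter (shiftY i) (UboxY i V) (((η : ℂ))⁻¹) (Sum.inr μ)) -
            conj b (diffLetter (shiftY i) (fun _ _ => (1 : 𝔸ˣ)) (((η : ℂ))⁻¹) (Sum.inr μ))) * G =
          -(conj b (mulDefB i V (((η : ℂ))⁻¹) μ) * (conj b ((shiftOpY' (𝔸 := 𝔸) i μ).restrictScalars ℝ) * G)) := by
        calc (conj b (diffLetter (shiftY i) (UboxY i V) (((η : ℂ))⁻¹) (Sum.inr μ)) -
              conj b (diffLetter (shiftY i) (fun _ _ => (1 : 𝔸ˣ)) (((η : ℂ))⁻¹) (Sum.inr μ))) * G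
            = (-(conj b (mulDefB i V (((η : ℂ))⁻¹) μ) * conj b ((shiftOpY' (𝔸 := 𝔸) i μ).restrictScalars ℝ))) * G := by
              rw [diffLetter_inr_eq_sub, conj_sub, sub_sub_cancel_left, B9Eq352DivFormLetters.conj_mul]
          _ = -((conj b (mulDefB i V (((η : ℂ))⁻¹) μ) * conj b ((shiftOpY' (𝔸 := 𝔸) i μ).restrictScalars ℝ)) * G) := LinearMap.ext fun _ => rfl
          _ = _ := by rw [mul_assoc]
      rw [e]
      exact B9Cor35GpCubeInputsAtOne.hasMajorant_neg (g := toB6 (geoCK i c) Rr H) _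
        (hasMajorant_mono (g := toB6 (geoCK i c) Rr H) _ (hasMajorant_mul_of_rowLocal (g := toB6 (geoCK i c) Rr H)
          (fun p : SiteY i × ι => blkCubeY i c p.1) (fun a => 5 * α₁ * ((geoCK i c).len a)⁻¹ * (M₂ * ∑ j, ‖b j‖)) (hlocB μ) (hshiftG' μ)) hresh)
  -- (2) RIGHT CORRECTION (backward letter): `(G·conj b(mulDefB))·conj b(σ_{−μ})`
  have hcorrR : ∀ μ, HasMajorant (g := toB6 (geoCK i c) Rr H) (fun p : SiteY i × ι => blkCubeY i c p.1)
      (G * (conj b (diffLetter (shiftY i) (UboxY i V) (((η : ℂ))⁻¹) (Sum.inr μ)) -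
        conj b (diffLetter (shiftY i) (fun _ _ => (1 : 𝔸ˣ)) (((η : ℂ))⁻¹) (Sum.inr μ))))
      (fun a a' => K₃ * (geoCK i c).len a * Real.exp (-((1 - 1 / 20) * ((1 - 1 / 20) * δ') * (geoCK i c).dist a a'))) := by
    intro μ
    have hin : HasMajorant (g := toB6 (geoCK i c) Rr H) (fun p : SiteY i × ι => blkCubeY i c p.1) (G * conj b (mulDefB i V (((η : ℂ))⁻¹) μ))
        (fun a a' => B * (geoCK i c).len a ^ 2 * Real.exp (-(δ' * (geoCK i c).dist a a')) * (5 * α₁ * (M₂ * ∑ j, ‖b j‖) * ((geoCK i c).len a')⁻¹)) :=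
      hasMajorant_mono (g := toB6 (geoCK i c) Rr H) _
        (hasMajorant_mul_of_rowLocal_right (g := toB6 (geoCK i c) Rr H) (fun p : SiteY i × ι => blkCubeY i c p.1)
          (fun a => 5 * α₁ * ((geoCK i c).len a)⁻¹ * (M₂ * ∑ j, ‖b j‖)) (fun a => mul_nonneg (hcF a) (mul_nonneg hM₂ hSb)) (hlocB μ) hG)
        fun a a' => le_of_eq (by ring)
    have hout := hasMajorant_weighted_mul_shift i c Rr H (fun p : SiteY i × ι => blkCubeY i c p.1) dB (δ := δ') (α := 1 / 20) (α' := 1 / 20)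
      (r := 5 * α₁ * (M₂ * ∑ j, ‖b j‖)) (A := B) (Λ := Λ4) (by positivity) hB hΛ4 hρ' (by norm_num) htri hPΛ' h261ρ hin
      (hasMajorant_conj_shiftOpY' i c b Rr H hρ' μ)
    have e : G * (conj b (diffLetter (shiftY i) (UboxY i V) (((η : ℂ))⁻¹) (Sum.inr μ)) -
          conj b (diffLetter (shiftY i) (fun _ _ => (1 : 𝔸ˣ)) (((η : ℂ))⁻¹) (Sum.inr μ))) =
        -(G * conj b (mulDefB i V (((η : ℂ))⁻¹) μ) * conj b ((shiftOpY' (𝔸 := 𝔸) i μ).restrictScalars ℝ)) := by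
      calc G * (conj b (diffLetter (shiftY i) (UboxY i V) (((η : ℂ))⁻¹) (Sum.inr μ)) -
            conj b (diffLetter (shiftY i) (fun _ _ => (1 : 𝔸ˣ)) (((η : ℂ))⁻¹) (Sum.inr μ)))
          = G * -(conj b (mulDefB i V (((η : ℂ))⁻¹) μ) * conj b ((shiftOpY' (𝔸 := 𝔸) i μ).restrictScalars ℝ)) := by
            rw [diffLetter_inr_eq_sub, conj_sub, sub_sub_cancel_left, B9Eq352DivFormLetters.conj_mul]
        _ = -(G * (conj b (mulDefB i V (((η : ℂ))⁻¹) μ) * conj b ((shiftOpY' (𝔸 := 𝔸) i μ).restrictScalars ℝ))) :=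
            LinearMap.ext fun v => map_neg G _
        _ = _ := by rw [mul_assoc]
    rw [e]
    refine B9Cor35GpCubeInputsAtOne.hasMajorant_neg (g := toB6 (geoCK i c) Rr H) _ (hasMajorant_mono (g := toB6 (geoCK i c) Rr H) _ hout fun a a' => ?_)
    have h54 : 5 * α₁ ≤ 5 / 4 := by linarith
    have hrest : 0 ≤ B * (M₂ * ∑ j, ‖b j‖) * Λ4 * Real.exp ((1 - 1 / 20) * δ') * cB ^ 2 * (geoCK i c).len a *
        Real.exp (-((1 - 1 / 20) * ((1 - 1 / 20) * δ') * (geoCK i c).dist a a')) :=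
      mul_nonneg (mul_nonneg (mul_nonneg (mul_nonneg (mul_nonneg (mul_nonneg hB (mul_nonneg hM₂ hSb)) hΛ4) (Real.exp_nonneg _)) (sq_nonneg _))
        (hlen0 a)) (Real.exp_nonneg _)
    have eρ : (1 - 1 / 20) * δ' = ρ := by rw [hρdef, hδ'def]
    calc B * (5 * α₁ * (M₂ * ∑ j, ‖b j‖)) * Λ4 * Real.exp ((1 - 1 / 20) * δ') * B6.c1 dB ((1 - 1 / 20) * δ') (1 / 20) ^ 2 * (geoCK i c).len a *
          Real.exp (-((1 - 1 / 20) * ((1 - 1 / 20) * δ') * (geoCK i c).dist a a'))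
        = 5 * α₁ * (B * (M₂ * ∑ j, ‖b j‖) * Λ4 * Real.exp ((1 - 1 / 20) * δ') * cB ^ 2 * (geoCK i c).len a *
          Real.exp (-((1 - 1 / 20) * ((1 - 1 / 20) * δ') * (geoCK i c).dist a a'))) := by rw [eρ, hcBdef]; ring
      _ ≤ 5 / 4 * (B * (M₂ * ∑ j, ‖b j‖) * Λ4 * Real.exp ((1 - 1 / 20) * δ') * cB ^ 2 * (geoCK i c).len a *
          Real.exp (-((1 - 1 / 20) * ((1 - 1 / 20) * δ') * (geoCK i c).dist a a'))) := mul_le_mul_of_nonneg_right h54 hrest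
      _ = K₃ * (geoCK i c).len a * Real.exp (-((1 - 1 / 20) * ((1 - 1 / 20) * δ') * (geoCK i c).dist a a')) := by rw [hK₃def, eρ]; ring
  -- (3) THE LAPLACIAN ENTRY via the equation
  have hparone : ∀ z w : SiteY i, parSymY i (fun _ _ => (1 : 𝔸ˣ)) z w = 1 := fun z w => parSymY_one i z w
  have hlocAvg : ∀ (w : SiteY i × ι → ℝ) (p : SiteY i × ι) (Mb : ℝ), (∀ p' : SiteY i × ι, blkCubeY i c p'.1 = blkCubeY i c p.1 → |w p'| ≤ Mb) →
      |conj b ((((η ^ 2)⁻¹ : ℝ)) • (kernelTrOpY (avgCoeffCubeY i c) (avgTrCubeY i c (parSymY i) V)).restrictScalars ℝ) w p| ≤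
        (1 + Cq d * α₁) ^ 2 * ((geoCK i c).len (blkCubeY i c p.1) ^ 2)⁻¹ * (M₂ * ∑ j, ‖b j‖) * Mb :=
    rowLocal_conj_of_local b (blkCubeY i c) (fun a => (1 + Cq d * α₁) ^ 2 * ((geoCK i c).len a ^ 2)⁻¹) hM₂ hrepr _ fun f x Bf' hBf' =>
      norm_avgCube_apply_le i c (parSymY i) h1A hparone V (Cq_nonneg d) hα₁0 hkF hsF f x Bf' hBf'
  have hAvgG : HasMajorant (g := toB6 (geoCK i c) Rr H) (fun p : SiteY i × ι => blkCubeY i c p.1)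
      (conj b ((((η ^ 2)⁻¹ : ℝ)) • (kernelTrOpY (avgCoeffCubeY i c) (avgTrCubeY i c (parSymY i) V)).restrictScalars ℝ) * G)
      (fun a a' => (1 + Cq d * (1 / 4)) ^ 2 * (M₂ * ∑ j, ‖b j‖) * B * 1 * Real.exp (-(δ' * (geoCK i c).dist a a'))) := by
    refine hasMajorant_mono (g := toB6 (geoCK i c) Rr H) _ (hasMajorant_mul_of_rowLocal (g := toB6 (geoCK i c) Rr H)
      (fun p : SiteY i × ι => blkCubeY i c p.1) (fun a => (1 + Cq d * α₁) ^ 2 * ((geoCK i c).len a ^ 2)⁻¹ * (M₂ * ∑ j, ‖b j‖)) hlocAvg hG) fun a a' => ?_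
    have hl := geoCK_len_pos i c a
    have e : ((geoCK i c).len a ^ 2)⁻¹ * (geoCK i c).len a ^ 2 = 1 := inv_mul_cancel₀ (pow_ne_zero 2 hl.ne')
    have hCq := Cq_nonneg d
    have hsq : (1 + Cq d * α₁) ^ 2 ≤ (1 + Cq d * (1 / 4)) ^ 2 := by
      have h0 : 0 ≤ 1 + Cq d * α₁ := by positivity
      have h1 : 1 + Cq d * α₁ ≤ 1 + Cq d * (1 / 4) := by nlinarith
      exact pow_le_pow_left₀ h0 h1 2
    have hrest : 0 ≤ (M₂ * ∑ j, ‖b j‖) * B * Real.exp (-(δ' * (geoCK i c).dist a a')) := by positivity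
    calc (1 + Cq d * α₁) ^ 2 * ((geoCK i c).len a ^ 2)⁻¹ * (M₂ * ∑ j, ‖b j‖) * (B * (geoCK i c).len a ^ 2 * Real.exp (-(δ' * (geoCK i c).dist a a')))
        = (1 + Cq d * α₁) ^ 2 * (((geoCK i c).len a ^ 2)⁻¹ * (geoCK i c).len a ^ 2) * ((M₂ * ∑ j, ‖b j‖) * B * Real.exp (-(δ' * (geoCK i c).dist a a'))) := by
          ring
      _ ≤ (1 + Cq d * (1 / 4)) ^ 2 * 1 * ((M₂ * ∑ j, ‖b j‖) * B * Real.exp (-(δ' * (geoCK i c).dist a a'))) := by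
          rw [e]; exact mul_le_mul_of_nonneg_right (mul_le_mul_of_nonneg_right hsq zero_le_one) hrest
      _ = _ := by ring
  have hLap : HasMajorant (g := toB6 (geoCK i c) Rr H) (fun p : SiteY i × ι => blkCubeY i c p.1)
      (conj b ((((η ^ 2)⁻¹ : ℝ)) • (lapSL i V).restrictScalars ℝ) * G)
      (fun a a' => K₄ * 1 * Real.exp (-(δ' * (geoCK i c).dist a a'))) := by
    have hid : conj b ((((η ^ 2)⁻¹ : ℝ)) • (lapSL i V).restrictScalars ℝ) * G =
        1 + -(conj b ((((η ^ 2)⁻¹ : ℝ)) • (kernelTrOpY (avgCoeffCubeY i c) (avgTrCubeY i c (parSymY i) V)).restrictScalars ℝ) * G) := by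
      rw [smul_lapSL_eq i c (parSymY i) V, conj_sub, ← DpK_sub_VpK b i c (parSymY i) A, sub_mul, hGdef, DpK_sub_VpK_mul_GpVK b i c (parSymY i) A hunit,
        sub_eq_add_neg]
    rw [hid]
    refine hasMajorant_mono (g := toB6 (geoCK i c) Rr H) _ (hasMajorant_add (g := toB6 (geoCK i c) Rr H) _ (hasMajorant_one_decay i c Rr H _ δ')
      (B9Cor35GpCubeInputsAtOne.hasMajorant_neg (g := toB6 (geoCK i c) Rr H) _ hAvgG)) fun a a' => ?_
    rw [hK₄def]
    exact le_of_eq (by ring)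
  -- (4) collect at `(B_f, (4/5)δ₀)`
  have hleB : B ≤ Bf := by rw [hBfdef]; linarith
  have hle2 : B + K₂ ≤ Bf := by rw [hBfdef]; linarith
  have hle3 : B + K₃ ≤ Bf := by rw [hBfdef]; linarith
  have hle4 : K₄ ≤ Bf := by rw [hBfdef]; linarith
  have hrate1 : 4 / 5 * δ₀ ≤ δ' := by rw [hδ'def]; linarith
  have hrate2 : 4 / 5 * δ₀ ≤ (1 - 1 / 20) * ((1 - 1 / 20) * δ') := by rw [hδ'def]; nlinarith
  refine ⟨hunit, hasMajorant_weaken i c Rr H _ hpow2 hleB hBf hrate1 hG, fun k => ?_, fun μ => ?_, ?_⟩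
  · -- `∇_{Ṽ,k}·G = ∇_{1,k}·G + (∇_{Ṽ,k} − ∇_{1,k})·G`
    have e : conj b (diffLetter (shiftY i) (UboxY i V) (((η : ℂ))⁻¹) k) * G =
        conj b (diffLetter (shiftY i) (fun _ _ => (1 : 𝔸ˣ)) (((η : ℂ))⁻¹) k) * G +
          (conj b (diffLetter (shiftY i) (UboxY i V) (((η : ℂ))⁻¹) k) - conj b (diffLetter (shiftY i) (fun _ _ => (1 : 𝔸ˣ)) (((η : ℂ))⁻¹) k)) * G := by
      rw [sub_mul, add_sub_cancel]
    rw [e]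
    refine hasMajorant_mono (g := toB6 (geoCK i c) Rr H) _ (hasMajorant_add (g := toB6 (geoCK i c) Rr H) _
      (hasMajorant_weaken i c Rr H _ hpow1 le_rfl hB hrate1 (hL1 k)) (hasMajorant_weaken i c Rr H _ hpow1 le_rfl hK₂ hrate2 (hcorrL k))) fun a a' => ?_
    have hx : 0 ≤ (geoCK i c).len a * Real.exp (-(4 / 5 * δ₀ * (geoCK i c).dist a a')) := mul_nonneg (hlen0 a) (Real.exp_nonneg _)
    nlinarith
  · have e : G * conj b (diffLetter (shiftY i) (UboxY i V) (((η : ℂ))⁻¹) (Sum.inr μ)) =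
        G * conj b (diffLetter (shiftY i) (fun _ _ => (1 : 𝔸ˣ)) (((η : ℂ))⁻¹) (Sum.inr μ)) +
          G * (conj b (diffLetter (shiftY i) (UboxY i V) (((η : ℂ))⁻¹) (Sum.inr μ)) -
            conj b (diffLetter (shiftY i) (fun _ _ => (1 : 𝔸ˣ)) (((η : ℂ))⁻¹) (Sum.inr μ))) := by
      rw [mul_sub, add_sub_cancel]
    rw [e]
    refine hasMajorant_mono (g := toB6 (geoCK i c) Rr H) _ (hasMajorant_add (g := toB6 (geoCK i c) Rr H) _
      (hasMajorant_weaken i c Rr H _ hpow1 le_rfl hB hrate1 (hR1 (Sum.inr μ))) (hasMajorant_weaken i c Rr H _ hpow1 le_rfl hK₃ hrate2 (hcorrR μ)))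
      fun a a' => ?_
    have hx : 0 ≤ (geoCK i c).len a * Real.exp (-(4 / 5 * δ₀ * (geoCK i c).dist a a')) := mul_nonneg (hlen0 a) (Real.exp_nonneg _)
    nlinarith
  · exact hasMajorant_weaken i c Rr H (fun _ => (1 : ℝ)) (fun _ => zero_le_one) hle4 hBf hrate1 hLap

end Main

end Literature.MathematicalPhysics.QuantumFieldTheory.Balaban1983to89.B9Cor36GpCubeEntriesAtV

end
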